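import Summits.FinalStateConjecture.FinalStateConjecture.Theorems.StarvedNecksNecksCertifyStubSeamFlatRestrict

/-!
# Route StarvedNecks — crux `NecksCertify`, line `two-cap-focusing-ledger`: seam surgery, deviation transport

Helper file for the registered stub `stub_seamSurgery` (N2): how the metric deviation of a chart
behaves under the two operations of the seam — replacing a chart by one that agrees with it on an
open set, and re-clocking the reference background (same domain, radius and reference form,
shifted time) along the inclusion of (equal) open domains:

* `stub_seamSurgery_transport` (registered helper sub-goal) / `deviation_congr_of_eventuallyEq` —
  charts agreeing near a point have the same deviation there; `supCkENorm_deviationExtend_congr` —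
  hence the same `Cᵏ` sup norms over subsets of an open set of agreement;
* `deviationExtend_comp_inclusion` — `Ψ ∘ inclusion` on a background with the same reference form
  has the same (extended) deviation;
* `deviation_clauses` — the metric clauses (structure field `tendsto_truncDeviationCk`, `Seamed`
  S2, S4, S5) of the re-clocked glued hole chart from the atlas clauses A6–A9.

Mathlib + the landed `…StubSeamFlatRestrict` module (`mfderiv_comp_inclusion_eq`); no definitions,
no named facts.
-/

noncomputable section

open scoped Manifold ContDiff Topology ENNReal
open Filter Set Function Topology Literature.Geometry.Lorentzian

namespace Summit.FinalStateConjecture.FinalStateConjecture.Theorems.NecksCertifyTwoCap.Seam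

set_option linter.dupNamespace false

section Transport

variable {𝓢 : Spacetime 4}

/-- Two charts on the same background which agree near a point have the same metric deviation
there (same value, same differential: `Filter.EventuallyEq.mfderiv_eq`). [folklore] -/
theorem deviation_congr_of_eventuallyEq (B : ModelBackground) {Ψ₁ Ψ₂ : B.domain → 𝓢.carrier}
    {x : B.domain} (h : Ψ₁ =ᶠ[𝓝 x] Ψ₂) :
    𝓢.deviation B Ψ₁ x = 𝓢.deviation B Ψ₂ x := by
  have hx : Ψ₁ x = Ψ₂ x := h.eq_of_nhds
  have hm : mfderiv 𝓘(ℝ, E4) (𝓡 4) Ψ₁ x = mfderiv 𝓘(ℝ, E4) (𝓡 4) Ψ₂ x := h.mfderiv_eq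
  refine ContinuousLinearMap.ext fun v ↦ ContinuousLinearMap.ext fun w ↦ ?_
  rw [Spacetime.deviation_apply, Spacetime.deviation_apply]
  have key : ∀ (p q : 𝓢.carrier) (hpq : p = q) (L₁ : E4 →L[ℝ] E4) (L₂ : E4 →L[ℝ] E4),
      L₁ = L₂ → (𝓢.metric.val p : E4 →L[ℝ] E4 →L[ℝ] ℝ) (L₁ v) (L₁ w) =
        (𝓢.metric.val q : E4 →L[ℝ] E4 →L[ℝ] ℝ) (L₂ v) (L₂ w) := by
    rintro p q rfl L₁ L₂ rfl; rfl
  exact congrArg (fun z ↦ z - B.bilin x.1 v w) (key _ _ hx _ _ hm)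

/-- Charts agreeing on an open set of the domain have equal extended deviations there, hence equal
iterated derivatives and equal `Cᵏ` sup norms over its subsets (locality of `iteratedFDeriv`).
[folklore] -/
theorem supCkENorm_deviationExtend_congr (B : ModelBackground) {Ψ₁ Ψ₂ : B.domain → 𝓢.carrier}
    {V : Set B.domain} (hV : IsOpen V) (h : ∀ x ∈ V, Ψ₁ x = Ψ₂ x) (k : ℕ) {S : Set B.domain}
    (hS : S ⊆ V) :
    supCkENorm (Subtype.val '' S) k (𝓢.deviationExtend B Ψ₁) =
      supCkENorm (Subtype.val '' S) k (𝓢.deviationExtend B Ψ₂) := by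
  have hpt : ∀ x ∈ V, 𝓢.deviationExtend B Ψ₁ x = 𝓢.deviationExtend B Ψ₂ x := fun x hx ↦ by
    rw [Spacetime.deviationExtend_coe, Spacetime.deviationExtend_coe]
    exact deviation_congr_of_eventuallyEq B (Filter.eventually_of_mem (hV.mem_nhds hx) h)
  -- the open subset of `E4` under `V`
  have hVE : IsOpen (Subtype.val '' V) := B.domain.isOpen.isOpenMap_subtype_val V hV
  have hev : ∀ x ∈ V, 𝓢.deviationExtend B Ψ₁ =ᶠ[𝓝 (x : E4)] 𝓢.deviationExtend B Ψ₂ := by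
    intro x hx
    filter_upwards [hVE.mem_nhds ⟨x, hx, rfl⟩] with y hy
    obtain ⟨z, hz, rfl⟩ := hy
    exact hpt z hz
  simp only [supCkENorm]
  refine iSup_congr fun m ↦ iSup_congr fun _ ↦ iSup_congr fun y ↦ iSup_congr fun hy ↦ ?_
  obtain ⟨x, hx, rfl⟩ := hy
  rw [((hev x (hS hx)).iteratedFDeriv ℝ m).eq_of_nhds]

/-- **Re-clocking a hole chart does not change its metric deviation.**  For backgrounds `B₁, B₂`
with `B₂.domain ≤ B₁.domain`, the same reference form on `B₂.domain` and a `C^∞` chart `Ψ₁` on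
`B₁.domain`, the deviation of `Ψ₁ ∘ inclusion` from `B₂` at `y` is the deviation of `Ψ₁` from `B₁`
at `y` (the inclusion of open subsets of `E4` has identity differential); if the two domains are
the same set, the two extended deviations are the same function on `E4`. [folklore] -/
theorem deviationExtend_comp_inclusion (B₁ B₂ : ModelBackground) (h : B₂.domain ≤ B₁.domain)
    (hset : (B₁.domain : Set E4) ⊆ B₂.domain) (hbilin : ∀ y : E4, B₂.bilin y = B₁.bilin y)
    (Ψ₁ : B₁.domain → 𝓢.carrier) (hΨ₁ : ContMDiff 𝓘(ℝ, E4) (𝓡 4) ∞ Ψ₁) :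
    (∀ y : B₂.domain, 𝓢.deviation B₂ (Ψ₁ ∘ TopologicalSpace.Opens.inclusion h) y =
      𝓢.deviation B₁ Ψ₁ (TopologicalSpace.Opens.inclusion h y)) ∧
    𝓢.deviationExtend B₂ (Ψ₁ ∘ TopologicalSpace.Opens.inclusion h) = 𝓢.deviationExtend B₁ Ψ₁ := by
  have h2 : ∀ y : B₂.domain, mfderiv 𝓘(ℝ, E4) (𝓡 4) (Ψ₁ ∘ TopologicalSpace.Opens.inclusion h) y =
      mfderiv 𝓘(ℝ, E4) (𝓡 4) Ψ₁ (TopologicalSpace.Opens.inclusion h y) := fun y ↦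
    NecksCertifyBargmann.FlatRestrict.mfderiv_comp_inclusion_eq h
      ((hΨ₁ _).mdifferentiableAt (by simp))
  have h3 : ∀ y : B₂.domain, 𝓢.deviation B₂ (Ψ₁ ∘ TopologicalSpace.Opens.inclusion h) y =
      𝓢.deviation B₁ Ψ₁ (TopologicalSpace.Opens.inclusion h y) := fun y ↦ by
    refine ContinuousLinearMap.ext fun v ↦ ContinuousLinearMap.ext fun w ↦ ?_
    rw [Spacetime.deviation_apply, Spacetime.deviation_apply, hbilin]
    exact congrArg (fun L : E4 →L[ℝ] TangentSpace (𝓡 4) (Ψ₁ (TopologicalSpace.Opens.inclusion h y)) ↦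
      𝓢.metric.val (Ψ₁ (TopologicalSpace.Opens.inclusion h y)) (L v) (L w) - B₁.bilin y.1 v w) (h2 y)
  refine ⟨h3, funext fun y ↦ ?_⟩
  by_cases hy : y ∈ B₂.domain
  · rw [show y = ((⟨y, hy⟩ : B₂.domain) : E4) from rfl, Spacetime.deviationExtend_coe, h3,
      show TopologicalSpace.Opens.inclusion h ⟨y, hy⟩ = (⟨y, h hy⟩ : B₁.domain) from rfl,
      ← Spacetime.deviationExtend_coe]
  · rw [Spacetime.deviationExtend_of_not_mem _ _ _ hy,
      Spacetime.deviationExtend_of_not_mem _ _ _ fun hy' ↦ hy (hset hy')]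

end Transport

/-- Registered helper sub-goal `stub_seamSurgery_transport` of N2: two charts on the same
background which agree near a point have the same metric deviation there. [folklore] -/
theorem stub_seamSurgery_transport :
    ∀ (𝓢 : Spacetime.{0} 4) (B : ModelBackground) (Ψ₁ Ψ₂ : B.domain → 𝓢.carrier) (x : B.domain),
      Ψ₁ =ᶠ[𝓝 x] Ψ₂ → 𝓢.deviation B Ψ₁ x = 𝓢.deviation B Ψ₂ x :=
  fun _ B _ _ _ h ↦ deviation_congr_of_eventuallyEq B h

section Deviation

variable {𝓢 : Spacetime 4}

/-- **Metric clauses of the re-clocked, glued hole chart** (structure field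
`tendsto_truncDeviationCk`, clauses S2, S4, S5 of `Seamed`).  With `B₁` the boosted Kerr background
of `(Λ, c)` and `B₂` the re-clocked one (`c ↦ c + Λ(s∂₀)`: same domain, radius and reference form,
time `− s`), the chart `Gl ∘ inclusion` on `B₂.domain` has the same extended deviation as `Gl` on
`B₁` (`deviationExtend_comp_inclusion`), and `Gl = Ψ'` on the open late part `{t > τ₁ + 2 + s,
r < b(t)}` of the certified tube, so its `C²` deviation on the re-clocked truncated slabs is that of
`Ψ'` (A6, A9), its `C⁰` deviation and the future-directedness of its pushed time-lines on the
certified tube are A7/A8 (flat-late tube points are hole-late by the choice of `T ≥ Y`).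
DHRT arXiv:2104.08222, §1. [folklore] -/
theorem deviation_clauses (Λ : lorentzGroup) (c : E4) (M a R₁ τ₁ s T Y : ℝ) (hs : 0 ≤ s)
    (hT3 : τ₁ + 3 ≤ T) (hTY : Y ≤ T)
    (Rg : ℝ → ℝ) (hA9 : Tendsto Rg atTop atTop)
    (b : ℝ → ℝ) (hbc : Continuous b) (hbRg : ∀ t, Rg t + 21 / 20 ≤ b t)
    (Ψ' Gl : (boostedKerrBackground Λ c M a).domain → 𝓢.carrier) (hGl1 : ContMDiff 𝓘(ℝ, E4) (𝓡 4) ∞ Gl)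
    (hGl2 : ∀ x : (boostedKerrBackground Λ c M a).domain, τ₁ + 2 + s ≤ (boostedKerrBackground Λ c M a).time x → (boostedKerrBackground Λ c M a).radius x < b ((boostedKerrBackground Λ c M a).time x) → Gl x = Ψ' x)
    (hA6 : Tendsto (fun τ ↦ 𝓢.truncDeviationCk (boostedKerrBackground Λ c M a) Ψ' 2 (Rg τ) τ) atTop (𝓝 0))
    (hA7 : supCkENorm (Subtype.val '' {x : (boostedKerrBackground Λ c M a).domain | τ₁ ≤ (boostedKerrBackground Λ c M a).time x ∧ R₁ ≤ (boostedKerrBackground Λ c M a).radius x ∧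
        (boostedKerrBackground Λ c M a).radius x ≤ Rg ((boostedKerrBackground Λ c M a).time x) + 2}) 0 (𝓢.deviationExtend (boostedKerrBackground Λ c M a) Ψ') ≤
      ENNReal.ofReal (1 / (10 * ‖((Λ : E4 ≃L[ℝ] E4) : E4 →L[ℝ] E4)‖ ^ 2)))
    (hA8 : ∀ x : (boostedKerrBackground Λ c M a).domain, τ₁ ≤ (boostedKerrBackground Λ c M a).time x → R₁ ≤ (boostedKerrBackground Λ c M a).radius x →
      (boostedKerrBackground Λ c M a).radius x ≤ Rg ((boostedKerrBackground Λ c M a).time x) + 2 →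
      𝓢.timeOrientation.IsFutureDirected
        (mfderiv 𝓘(ℝ, E4) (𝓡 4) Ψ' x ((Λ : E4 ≃L[ℝ] E4) (E4.basisVector 0))))
    (hY : ∀ y : E4, Y ≤ y 0 → (boostedKerrBackground Λ c M a).radius y ≤ Rg ((boostedKerrBackground Λ c M a).time y) + 2 → τ₁ + 3 ≤ (boostedKerrBackground Λ c M a).time y - s)
    (B₂ : ModelBackground) (h : B₂.domain ≤ (boostedKerrBackground Λ c M a).domain)
    (hset : ((boostedKerrBackground Λ c M a).domain : Set E4) ⊆ B₂.domain) (htime : ∀ y, B₂.time y = (boostedKerrBackground Λ c M a).time y - s)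
    (hrad : ∀ y, B₂.radius y = (boostedKerrBackground Λ c M a).radius y) (hbilin : ∀ y, B₂.bilin y = (boostedKerrBackground Λ c M a).bilin y) :
    (∀ R' : ℝ, Tendsto (fun τ ↦ 𝓢.truncDeviationCk B₂ (Gl ∘ TopologicalSpace.Opens.inclusion h)
      2 R' τ) atTop (𝓝 0)) ∧
    Tendsto (fun τ ↦ 𝓢.truncDeviationCk B₂ (Gl ∘ TopologicalSpace.Opens.inclusion h) 2
      (Rg (τ + s)) τ) atTop (𝓝 0) ∧
    supCkENorm (Subtype.val '' {x : B₂.domain | (T ≤ B₂.time x ∨ T ≤ x.1 0) ∧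
        R₁ ≤ B₂.radius x ∧ B₂.radius x ≤ Rg (B₂.time x + s)}) 0
      (𝓢.deviationExtend B₂ (Gl ∘ TopologicalSpace.Opens.inclusion h)) ≤
      ENNReal.ofReal (1 / (10 * ‖((Λ : E4 ≃L[ℝ] E4) : E4 →L[ℝ] E4)‖ ^ 2)) ∧
    (∀ x : B₂.domain, (T ≤ B₂.time x ∨ T ≤ x.1 0) → R₁ ≤ B₂.radius x →
      B₂.radius x ≤ Rg (B₂.time x + s) →
      𝓢.timeOrientation.IsFutureDirected (mfderiv 𝓘(ℝ, E4) (𝓡 4)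
        (Gl ∘ TopologicalSpace.Opens.inclusion h) x ((Λ : E4 ≃L[ℝ] E4) (E4.basisVector 0)))) := by
  have hTc : Continuous (boostedKerrBackground Λ c M a).time := (PiLp.continuous_apply 2 _ 0).comp (continuous_poincareInv Λ c)
  have hRc : Continuous (boostedKerrBackground Λ c M a).radius := (Kerr.continuous_radius a).comp (continuous_poincareInv Λ c)
  -- (K1) the two extended deviations are the same function
  obtain ⟨-, hK1⟩ := deviationExtend_comp_inclusion (𝓢 := 𝓢) (boostedKerrBackground Λ c M a) B₂ h hset hbilin Gl hGl1
  -- (K2) on the late small-radius region `Gl = Ψ'`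
  set V : Set (boostedKerrBackground Λ c M a).domain := {x | τ₁ + 2 + s < (boostedKerrBackground Λ c M a).time x ∧ (boostedKerrBackground Λ c M a).radius x < b ((boostedKerrBackground Λ c M a).time x)} with hV
  have hVo : IsOpen V := (isOpen_lt continuous_const (hTc.comp continuous_subtype_val)).inter
    (isOpen_lt (hRc.comp continuous_subtype_val) (hbc.comp (hTc.comp continuous_subtype_val)))
  have hK2 : ∀ (k : ℕ) {S : Set (boostedKerrBackground Λ c M a).domain}, S ⊆ V → supCkENorm (Subtype.val '' S) k
      (𝓢.deviationExtend (boostedKerrBackground Λ c M a) Gl) = supCkENorm (Subtype.val '' S) k (𝓢.deviationExtend (boostedKerrBackground Λ c M a) Ψ') :=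
    fun k S hS ↦ supCkENorm_deviationExtend_congr (boostedKerrBackground Λ c M a) hVo (fun x hx ↦ hGl2 x hx.1.le hx.2) k hS
  -- transfer of `val`-images between the two (equal) domains
  have himg : ∀ (S₂ : Set B₂.domain) (S₁ : Set (boostedKerrBackground Λ c M a).domain),
      (∀ x : B₂.domain, x ∈ S₂ ↔ (⟨x.1, h x.2⟩ : (boostedKerrBackground Λ c M a).domain) ∈ S₁) →
      Subtype.val '' S₂ = Subtype.val '' S₁ := by
    intro S₂ S₁ hiff
    ext y
    constructor
    · rintro ⟨x, hx, rfl⟩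
      exact ⟨⟨x.1, h x.2⟩, (hiff x).mp hx, rfl⟩
    · rintro ⟨x, hx, rfl⟩
      have hx2 : (x : E4) ∈ B₂.domain := hset x.2
      exact ⟨⟨x.1, hx2⟩, (hiff ⟨x.1, hx2⟩).mpr hx, rfl⟩
  -- truncated slabs
  have hslab : ∀ R' τ, 𝓢.truncDeviationCk B₂ (Gl ∘ TopologicalSpace.Opens.inclusion h) 2 R' τ =
      supCkENorm (Subtype.val '' {x : (boostedKerrBackground Λ c M a).domain | (boostedKerrBackground Λ c M a).time x = τ + s ∧ (boostedKerrBackground Λ c M a).radius x ≤ R'}) 2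
        (𝓢.deviationExtend (boostedKerrBackground Λ c M a) Gl) := by
    intro R' τ
    unfold Spacetime.truncDeviationCk
    rw [hK1, himg (B₂.truncTimeSlab R' τ) {x : (boostedKerrBackground Λ c M a).domain | (boostedKerrBackground Λ c M a).time x = τ + s ∧ (boostedKerrBackground Λ c M a).radius x ≤ R'}]
    intro x
    simp only [ModelBackground.mem_truncTimeSlab, mem_setOf_eq, htime, hrad]
    constructor
    · rintro ⟨h1, h2⟩; exact ⟨by linarith, h2⟩
    · rintro ⟨h1, h2⟩; exact ⟨by show (boostedKerrBackground Λ c M a).time x.1 - s = τ; linarith, h2⟩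
  have hslab' : ∀ R' τ, τ₁ + 2 < τ → R' < b (τ + s) →
      𝓢.truncDeviationCk B₂ (Gl ∘ TopologicalSpace.Opens.inclusion h) 2 R' τ =
        𝓢.truncDeviationCk (boostedKerrBackground Λ c M a) Ψ' 2 R' (τ + s) := by
    intro R' τ hτ hR'
    rw [hslab, hK2 2 (fun x hx ↦ ⟨by rw [hx.1]; linarith, by rw [hx.1]; exact hx.2.trans_lt hR'⟩)]
    rfl
  -- (D2) along the re-clocked certified radii
  have hshift : Tendsto (fun τ : ℝ ↦ τ + s) atTop atTop := tendsto_atTop_add_const_right _ _ tendsto_id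
  have hD2 : Tendsto (fun τ ↦ 𝓢.truncDeviationCk B₂ (Gl ∘ TopologicalSpace.Opens.inclusion h) 2
      (Rg (τ + s)) τ) atTop (𝓝 0) := by
    refine (hA6.comp hshift).congr' ?_
    filter_upwards [eventually_gt_atTop (τ₁ + 2)] with τ hτ
    exact (hslab' (Rg (τ + s)) τ hτ (by linarith [hbRg (τ + s)])).symm
  refine ⟨fun R' ↦ ?_, hD2, ?_, ?_⟩
  · -- (D1) fixed radius: eventually below the certified radius
    obtain ⟨τR, hτR⟩ := eventually_atTop.1 ((hA9.comp hshift).eventually (eventually_ge_atTop R'))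
    refine tendsto_of_tendsto_of_tendsto_of_le_of_le' tendsto_const_nhds hD2
      (Eventually.of_forall fun _ ↦ bot_le) ?_
    filter_upwards [eventually_ge_atTop τR] with τ hτ
    exact 𝓢.truncDeviationCk_mono _ _ 2 (hτR τ hτ) τ
  · -- (D3) `C⁰` honesty on the certified tube
    set S₁ : Set (boostedKerrBackground Λ c M a).domain := {x | (T ≤ (boostedKerrBackground Λ c M a).time x - s ∨ T ≤ x.1 0) ∧ R₁ ≤ (boostedKerrBackground Λ c M a).radius x ∧
      (boostedKerrBackground Λ c M a).radius x ≤ Rg ((boostedKerrBackground Λ c M a).time x)} with hS₁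
    have hlate : ∀ x ∈ S₁, τ₁ + 3 + s ≤ (boostedKerrBackground Λ c M a).time x := by
      rintro x ⟨h1 | h1, h2, h3⟩
      · linarith
      · have := hY x.1 (hTY.trans h1) (by linarith)
        linarith
    rw [himg _ S₁, hK1, hK2 0 (fun x hx ↦ ⟨by linarith [hlate x hx], hx.2.2.trans_lt
      (by linarith [hbRg ((boostedKerrBackground Λ c M a).time x.1)])⟩)]
    · refine (supCkENorm_mono (image_mono fun x hx ↦ ?_) 0 _).trans hA7
      exact ⟨by linarith [hlate x hx], hx.2.1, by linarith [hx.2.2]⟩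
    · intro x
      simp only [mem_setOf_eq, htime, hrad, sub_add_cancel]
      rfl
  · -- (D4) future-directed pushed time-lines
    intro x hx hr1 hr2
    have hr1' : R₁ ≤ (boostedKerrBackground Λ c M a).radius x.1 := by rw [← hrad]; exact hr1
    have hr2' : (boostedKerrBackground Λ c M a).radius x.1 ≤ Rg ((boostedKerrBackground Λ c M a).time x.1) := by
      have h2 := hr2; rwa [hrad, htime, sub_add_cancel] at h2
    have hlate : τ₁ + 3 + s ≤ (boostedKerrBackground Λ c M a).time x.1 := by
      rcases hx with h1 | h1
      · rw [htime] at h1; linarith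
      · have := hY x.1 (hTY.trans h1) (by linarith)
        linarith
    have hmf : mfderiv 𝓘(ℝ, E4) (𝓡 4) (Gl ∘ TopologicalSpace.Opens.inclusion h) x =
        mfderiv 𝓘(ℝ, E4) (𝓡 4) Gl (TopologicalSpace.Opens.inclusion h x) :=
      NecksCertifyBargmann.FlatRestrict.mfderiv_comp_inclusion_eq h
        ((hGl1 _).mdifferentiableAt (WithTop.coe_ne_zero.mpr ENat.top_ne_zero))
    have hxV : TopologicalSpace.Opens.inclusion h x ∈ V :=
      ⟨by show τ₁ + 2 + s < (boostedKerrBackground Λ c M a).time x.1; linarith,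
        by show (boostedKerrBackground Λ c M a).radius x.1 < b ((boostedKerrBackground Λ c M a).time x.1); linarith [hbRg ((boostedKerrBackground Λ c M a).time x.1)]⟩
    have hev : Gl =ᶠ[𝓝 (TopologicalSpace.Opens.inclusion h x)] Ψ' :=
      Filter.eventually_of_mem (hVo.mem_nhds hxV) fun y hy ↦ hGl2 y hy.1.le hy.2
    have hpt : (Gl ∘ TopologicalSpace.Opens.inclusion h) x = Ψ' (TopologicalSpace.Opens.inclusion h x) :=
      hGl2 _ (by show τ₁ + 2 + s ≤ (boostedKerrBackground Λ c M a).time x.1; linarith)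
        (by show (boostedKerrBackground Λ c M a).radius x.1 < b ((boostedKerrBackground Λ c M a).time x.1); linarith [hbRg ((boostedKerrBackground Λ c M a).time x.1)])
    have key := hA8 (TopologicalSpace.Opens.inclusion h x) (by show τ₁ ≤ (boostedKerrBackground Λ c M a).time x.1; linarith)
      (by show R₁ ≤ (boostedKerrBackground Λ c M a).radius x.1; exact hr1') (by show (boostedKerrBackground Λ c M a).radius x.1 ≤ Rg ((boostedKerrBackground Λ c M a).time x.1) + 2; linarith)
    rw [← hev.mfderiv_eq, ← hmf] at key
    rw [hpt]
    exact key

end Deviation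

end Summit.FinalStateConjecture.FinalStateConjecture.Theorems.NecksCertifyTwoCap.Seam

end
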